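import Summits.Ventures.GridStability.Bench.WSCC9LossySplitLinesLPRoa
import Literature.MathematicalPhysics.PowerSystems.LuriePostnikovSlabInnerBall
import HarnessLib

/-!
# GridStability/Bench/WSCC9LossySplitLinesBall — the CERTIFIED inner ball of ★ #122's region («SPLITU-8°»,
# class of record at `2·arctan(7/100)`) and the certified REGION comparison with the positivity class at 8.464°

Cell `gridfusion` — LADDER-GRIDFUSION **G2.c**; seat gridfusion-lit-6 (g9).  Companion of ★ #122
(`Bench/WSCC9LossySplitLinesRoa.lean`: `lossy_splitLines_slab_roa` at `2·arctan(7/100)` with sos-2's certificate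
`WSCC9LossySplitLines.cert : SlabCertificate WSCC9.splitLurieLinesSystem`, level `c_rk = cRkQ`) and of «SPLITU-LP-8.46°»
(`Bench/WSCC9LossySplitLinesLPRoa.lean`: the positivity certificate's region at `2·arctan(37/500)` with its
certified ball `rho2LQ = 405979/62500000`).  Here ★ #122's «inner ball» reading is made a THEOREM by lit-6's
`SlabCertificate.ball_subset_well` (`LuriePostnikovSlabInnerBall.lean`): with `t = 997/1024`
(`t·1 − (P + Cᵀ·diag(λb)·C) ⪰ 0`, kernel `LDLᵀ` on the formula) and `ϱ = 3628457/5·10¹¹` (`t·ϱ ≤ c_rk`,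
`2ϱ ≤ γ_lo²`) the Euclidean ball `{x : xᵀx ≤ ϱ}` (`√ϱ ≈ 0.00269`) of Lur'e states lies in ★ #122's certified
well — and `ball_ratio`: `895·ϱ ≤ ϱ_LP`, i.e. the positivity certificate's certified ball at the WIDER window
8.464° has ≥ 29.9× the radius of the class-of-record certificate's at 8.008° (both CERTIFIED inner estimates
of their wells; the wells themselves are not compared).
THREE COLUMNS.  CERTIFIED: ball ⊆ well ⊆ ROA for MODEL M′ = `WSCC9.postB_SPdamp.toModel`, and the rational
inequality between the two certified radii².  VALIDATED: nothing new.  MODELLED: as ★ #122; inner estimates —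
a larger certified ball does not say the true region of attraction differs.
[cite: Khalil2002, Theorem 4.10 (hypothesis (4.25)); VuTuritsyn2017, §4.3 Theorem 1 (set ℛ); Pai1981, §2.16 Theorem [18]]
-/

noncomputable section

open Set Filter Topology Real Matrix
open Literature.MathematicalPhysics.PowerSystems
open Literature.MathematicalPhysics.PowerSystems.LyapunovFunctionFamily
open Literature.Computation.Certificates
open Summit.Ventures.GridStability.Models
open Summit.Ventures.GridStability.Lyapunov.WSCC9LossySplitSlab (e1 eκ CQ)
open Summit.Ventures.GridStability.Lyapunov.WSCC9LossySplitLines (C_eq cert PQ lamK bK gloQ cRkQ glo_test)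
open Summit.Ventures.GridStability.Bench.WSCC9LossySplitLines (hsec gloQ_lt_gamma lossy_splitLines_slab_roa)

namespace Summit.Ventures.GridStability.Bench.WSCC9LossySplitLinesBall

/-- The upper constant `t = 997/1024` (`t·1 − (P + Cᵀ·diag(λb)·C) ⪰ 0` for ★ #122's certificate). -/
def tBQ : ℚ := 997 / 1024

/-- The certified ball radius² of ★ #122's region: `ϱ = 3628457/5·10¹¹` (`√ϱ ≈ 0.00269`). -/
def rho2BQ : ℚ := 3628457 / 500000000000

/-- The upper comparison matrix `P + Cᵀ·diag(λ_k b_k)·C` of ★ #122's certificate over `ℚ` (typed index). -/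
def upperBQ : Matrix (Fin 3 ⊕ Fin 2) (Fin 3 ⊕ Fin 2) ℚ :=
  PQ + CQᵀ * Matrix.diagonal (fun k => lamK k * bK k) * CQ

set_option maxHeartbeats 4000000 in
/-- **`t·1 − (P + Cᵀ·diag(λb)·C) ⪰ 0`** for ★ #122's certificate (5 × 5), decided in the kernel on the formula. -/
theorem upperB_ldl :
    PSD.LDLCert ((tBQ • (1 : Matrix (Fin 3 ⊕ Fin 2) (Fin 3 ⊕ Fin 2) ℚ) - upperBQ).submatrix e1.symm e1.symm) := by
  decide +kernel

/-- The ball tests: `0 ≤ t`, `t·ϱ ≤ c_rk`, `2ϱ ≤ γ_lo²`, `0 < ϱ` (★ #122's `cRkQ`, `gloQ`). -/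
theorem ballB_tests : 0 ≤ tBQ ∧ tBQ * rho2BQ ≤ cRkQ ∧ 2 * rho2BQ ≤ gloQ ^ 2 ∧ 0 < rho2BQ := by
  refine ⟨?_, ?_, ?_, ?_⟩ <;> norm_num [tBQ, rho2BQ, cRkQ, gloQ]

/-- **The certified radii² compare as `895·ϱ_122 ≤ ϱ_LP`** (radius ratio `≥ √895 > 29.9`). -/
theorem ball_ratio : 895 * rho2BQ ≤ WSCC9LossySplitLinesLP.rho2LQ := by
  norm_num [rho2BQ, WSCC9LossySplitLinesLP.rho2LQ]

/-- `(M·N) ↦ ℝ` (plumbing). -/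
private theorem map_mul' {m n o : Type*} [Fintype n] (M : Matrix m n ℚ) (N : Matrix n o ℚ) :
    (M * N).map (Rat.cast : ℚ → ℝ) = M.map (Rat.cast : ℚ → ℝ) * N.map (Rat.cast : ℚ → ℝ) :=
  Matrix.map_mul (f := Rat.castHom ℝ)
/-- `(M + N) ↦ ℝ` (plumbing). -/
private theorem map_add' {m n : Type*} (M N : Matrix m n ℚ) :
    (M + N).map (Rat.cast : ℚ → ℝ) = M.map (Rat.cast : ℚ → ℝ) + N.map (Rat.cast : ℚ → ℝ) := by
  ext; simp
/-- `(M − N) ↦ ℝ` (plumbing). -/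
private theorem map_sub' {m n : Type*} (M N : Matrix m n ℚ) :
    (M - N).map (Rat.cast : ℚ → ℝ) = M.map (Rat.cast : ℚ → ℝ) - N.map (Rat.cast : ℚ → ℝ) := by
  ext; simp
/-- `Mᵀ ↦ ℝ` (plumbing). -/
private theorem map_transpose' {m n : Type*} (M : Matrix m n ℚ) :
    Mᵀ.map (Rat.cast : ℚ → ℝ) = (M.map (Rat.cast : ℚ → ℝ))ᵀ := by
  ext; simp
/-- `diagonal d ↦ ℝ` (plumbing). -/
private theorem map_diagonal' {n : Type*} [DecidableEq n] (d : n → ℚ) :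
    (Matrix.diagonal d).map (Rat.cast : ℚ → ℝ) = Matrix.diagonal (fun i => ((d i : ℚ) : ℝ)) :=
  Matrix.diagonal_map (Rat.cast_zero)
/-- `(q • 1) ↦ ℝ` (plumbing). -/
private theorem map_smul_one' {n : Type*} [DecidableEq n] (q : ℚ) :
    (q • (1 : Matrix n n ℚ)).map (Rat.cast : ℚ → ℝ) = ((q : ℚ) : ℝ) • (1 : Matrix n n ℝ) := by
  ext i j; by_cases h : i = j <;> simp [h]

/-- **`cert.upperMatrix = upperBQ ↦ ℝ`** (★ #122's certificate; `cert.P = PQ ↦ ℝ`, `cert.lam/b` the casts of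
`lamK/bK`, all definitional). -/
theorem upperMatrix_eq : cert.upperMatrix = upperBQ.map (Rat.cast : ℚ → ℝ) := by
  have hd : Matrix.diagonal (fun k => cert.lam k * cert.b k)
      = (Matrix.diagonal (fun k => lamK k * bK k)).map (Rat.cast : ℚ → ℝ) := by
    rw [map_diagonal']
    congr 1; funext k
    show ((lamK k : ℚ) : ℝ) * ((bK k : ℚ) : ℝ) = _
    push_cast; rfl
  rw [SlabCertificate.upperMatrix_def, hd, C_eq, upperBQ]
  show (PQ.map (Rat.cast : ℚ → ℝ)) + _ = _
  simp only [map_add', map_mul', map_transpose']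

/-- **`t·1 − upperMatrix ⪰ 0` over `ℝ`** for ★ #122's certificate. -/
theorem upper_psd :
    (((tBQ : ℚ) : ℝ) • (1 : Matrix (Fin 3 ⊕ Fin 2) (Fin 3 ⊕ Fin 2) ℝ) - cert.upperMatrix).PosSemidef := by
  have h : ((tBQ : ℚ) : ℝ) • (1 : Matrix (Fin 3 ⊕ Fin 2) (Fin 3 ⊕ Fin 2) ℝ) - cert.upperMatrix
      = (tBQ • (1 : Matrix (Fin 3 ⊕ Fin 2) (Fin 3 ⊕ Fin 2) ℚ) - upperBQ).map (Rat.cast : ℚ → ℝ) := by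
    rw [upperMatrix_eq, map_sub', map_smul_one']
  rw [h]
  have hpsd := (upperB_ldl.posSemidef (R := ℝ)).submatrix e1
  have e : (((tBQ • (1 : Matrix (Fin 3 ⊕ Fin 2) (Fin 3 ⊕ Fin 2) ℚ) - upperBQ).submatrix ⇑e1.symm ⇑e1.symm).map
      (Rat.cast : ℚ → ℝ)).submatrix e1 e1
      = (tBQ • (1 : Matrix (Fin 3 ⊕ Fin 2) (Fin 3 ⊕ Fin 2) ℚ) - upperBQ).map (Rat.cast : ℚ → ℝ) := by
    ext i j; simp
  rwa [e] at hpsd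

/-- **THE CERTIFIED INNER BALL of ★ #122's region**: the Euclidean ball `{x : xᵀx ≤ ϱ}`, `ϱ = 3628457/5·10¹¹`,
of Lur'e states lies in the certified well `{slab 2·arctan(7/100), V ≤ c_rk}` of sos-2's certificate.
[cite: Khalil2002, Theorem 4.10 (hypothesis (4.25)); VuTuritsyn2017, §4.3 Theorem 1 (set ℛ)] -/
theorem ball_subset_well122 :
    {x : Fin 3 ⊕ Fin 2 → ℝ | x ⬝ᵥ x ≤ ((rho2BQ : ℚ) : ℝ)}
      ⊆ {x | x ∈ WSCC9.splitLurieLinesSystem.slab (fun _ => 2 * Real.arctan (7 / 100 : ℝ)) ∧ cert.V x ≤ ((cRkQ : ℚ) : ℝ)} := by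
  have hγ : (0 : ℝ) < 2 * Real.arctan (7 / 100 : ℝ) := by
    have := Real.arctan_pos.mpr (show (0 : ℝ) < 7 / 100 by norm_num)
    linarith
  refine cert.ball_subset_well (γ := fun _ => 2 * Real.arctan (7 / 100 : ℝ)) (fun _ => hγ)
    (by exact_mod_cast ballB_tests.1) upper_psd hsec (by exact_mod_cast ballB_tests.2.1) fun k => ?_
  have hC : WSCC9.splitLurieLinesSystem.C k = fun i => ((CQ k i : ℚ) : ℝ) := by
    rw [C_eq]; rfl
  have h1 : WSCC9.splitLurieLinesSystem.C k ⬝ᵥ WSCC9.splitLurieLinesSystem.C k = ((CQ k ⬝ᵥ CQ k : ℚ) : ℝ) := by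
    rw [hC]; simp [dotProduct]
  have h2 : ((CQ k ⬝ᵥ CQ k : ℚ) : ℝ) ≤ 2 := by exact_mod_cast WSCC9LossySplitLinesLP.CQ_sq_le_two k
  have h3 : (2 : ℝ) * ((rho2BQ : ℚ) : ℝ) ≤ ((gloQ : ℚ) : ℝ) ^ 2 := by exact_mod_cast ballB_tests.2.2.1
  have h4 : ((gloQ : ℚ) : ℝ) ^ 2 < (2 * Real.arctan (7 / 100 : ℝ)) ^ 2 :=
    pow_lt_pow_left₀ gloQ_lt_gamma (by exact_mod_cast glo_test.1) two_ne_zero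
  have h5 : (0 : ℝ) < ((rho2BQ : ℚ) : ℝ) := by exact_mod_cast ballB_tests.2.2.2
  rw [h1]
  nlinarith

/-- **★ #122, ball form**: every solution of M′ on `ℝ` whose initial Lur'e state has `|x(0)|² ≤ 3628457/5·10¹¹` keeps
the slab `2·arctan(7/100)` and `V ≤ c_rk` for all `t ≥ 0` and has `lurieState → 0`.  CERTIFIED for MODEL M′ (inner
estimate). [cite: VuTuritsyn2017, §4.3 Theorem 1; Pai1981, §2.16 Theorem [18]] -/
theorem lossy_splitLines_ball_roa {c : ℝ → ClassicalSwing.State 3}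
    (hc : WSCC9.postB_SPdamp.toModel.IsSolutionOn c univ)
    (h0 : WSCC9.postB_SPdamp.lurieState WSCC9.postB_SPdamp.angleOf (c 0) ⬝ᵥ WSCC9.postB_SPdamp.lurieState WSCC9.postB_SPdamp.angleOf (c 0) ≤ ((rho2BQ : ℚ) : ℝ)) :
    (∀ t, 0 ≤ t →
        WSCC9.postB_SPdamp.lurieState WSCC9.postB_SPdamp.angleOf (c t) ∈ WSCC9.splitLurieLinesSystem.slab (fun _ => 2 * Real.arctan (7 / 100 : ℝ)) ∧
          cert.V (WSCC9.postB_SPdamp.lurieState WSCC9.postB_SPdamp.angleOf (c t)) ≤ ((cRkQ : ℚ) : ℝ)) ∧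
      Tendsto (fun t => WSCC9.postB_SPdamp.lurieState WSCC9.postB_SPdamp.angleOf (c t)) atTop (𝓝 0) := by
  have hw := ball_subset_well122 h0
  exact lossy_splitLines_slab_roa le_rfl hc hw.1 hw.2

/-- **BOTH certified balls, side by side** (one kernel object for the «price = region» clause): every solution
of M′ from the ball `|x(0)|² ≤ ϱ_122` synchronises by ★ #122's certificate, every solution from the ≥ 29.9×-wider
ball `|x(0)|² ≤ ϱ_LP` synchronises by the positivity certificate at 8.464°, and `895·ϱ_122 ≤ ϱ_LP`. -/
theorem certified_balls :
    (∀ c : ℝ → ClassicalSwing.State 3, WSCC9.postB_SPdamp.toModel.IsSolutionOn c univ →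
      WSCC9.postB_SPdamp.lurieState WSCC9.postB_SPdamp.angleOf (c 0) ⬝ᵥ WSCC9.postB_SPdamp.lurieState WSCC9.postB_SPdamp.angleOf (c 0) ≤ ((rho2BQ : ℚ) : ℝ) →
        Tendsto (fun t => WSCC9.postB_SPdamp.lurieState WSCC9.postB_SPdamp.angleOf (c t)) atTop (𝓝 0)) ∧
    (∀ c : ℝ → ClassicalSwing.State 3, WSCC9.postB_SPdamp.toModel.IsSolutionOn c univ →
      WSCC9.postB_SPdamp.lurieState WSCC9.postB_SPdamp.angleOf (c 0) ⬝ᵥ WSCC9.postB_SPdamp.lurieState WSCC9.postB_SPdamp.angleOf (c 0) ≤ ((WSCC9LossySplitLinesLP.rho2LQ : ℚ) : ℝ) →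
        Tendsto (fun t => WSCC9.postB_SPdamp.lurieState WSCC9.postB_SPdamp.angleOf (c t)) atTop (𝓝 0)) ∧
    895 * rho2BQ ≤ WSCC9LossySplitLinesLP.rho2LQ :=
  ⟨fun _ hc h0 => (lossy_splitLines_ball_roa hc h0).2,
    fun _ hc h0 => (WSCC9LossySplitLinesLP.lossy_splitLinesLP_ball_roa hc h0).2, ball_ratio⟩

end Summit.Ventures.GridStability.Bench.WSCC9LossySplitLinesBall

end
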